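import Summits.AnomalousDissipation.AnomalousDissipation.Theorems.SolenoidalFractalHomogenisationRealisedQuasiStaticCellLawGammaFloor
import Summits.AnomalousDissipation.AnomalousDissipation.Theorems.SolenoidalFractalHomogenisationRealisedQuasiStaticCellLawCosetGeometry
import HarnessLib

/-!
# K2R `RealisedQuasiStaticCellLaw`, line `floquet-bloch`: positivity (with an explicit floor) of the in-plane link `p₀·p₁` of a
# principal coset — the hypothesis `γ² > 0` of `sectorDecay_ae` (helper towards `stub_lowSectorDecay`; `--supports stmt-AnomalousDissipation-20446`)

Summits-side helper file (everything proved; no definitions, no named facts). For the in-plane frame `p_J = |k_J|⁻¹ k_J × ζ` of the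
coset `k_J = ℓ + J•K` (`ζ` unit, normal to `ℓ` and `K`): `p₀·p₁ = k̂₀·k̂₁` (`inPlane_link_eq_cos`) and
`|k̂₀·k̂₁| ≥ (|ℓ·K| − |ℓ|²)/(|ℓ|(|ℓ|+|K|))` (`cos_coset_neighbour_ge`); hence `|p₀·p₁| ≥ (|ℓ·K| − |ℓ|²)/(|ℓ|(|ℓ|+|K|))`
(`abs_inPlane_link_ge`) and `γ² = (p₀·p₁)² + (p₋₁·p₀)² > 0` as soon as `|ℓ·K| > |ℓ|²` (`gamma_sq_pos`; recipe v2 §(i)).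
-/

set_option linter.dupNamespace false

noncomputable section

namespace Summit.AnomalousDissipation.AnomalousDissipation.Theorems.SolenoidalFractalHomogenisation.RealisedQuasiStaticCellLaw

open Matrix
open scoped Matrix

/-- **Floor for the first in-plane link of a principal coset.** -/
theorem abs_inPlane_link_ge (ℓ K : Fin 3 → ℤ) (hℓ : ℓ ≠ 0) (hK : K ≠ 0) {ζr : Fin 3 → ℝ} (hζ1 : ζr ⬝ᵥ ζr = 1)
    (hζ0 : ζr ⬝ᵥ (fun i => ((ℓ i : ℤ) : ℝ)) = 0) (hζK : ζr ⬝ᵥ (fun i => ((K i : ℤ) : ℝ)) = 0) :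
    (|(fun i => ((ℓ i : ℤ) : ℝ)) ⬝ᵥ (fun i => ((K i : ℤ) : ℝ))| - (fun i => ((ℓ i : ℤ) : ℝ)) ⬝ᵥ (fun i => ((ℓ i : ℤ) : ℝ))) /
        (Real.sqrt ((fun i => ((ℓ i : ℤ) : ℝ)) ⬝ᵥ (fun i => ((ℓ i : ℤ) : ℝ))) *
          (Real.sqrt ((fun i => ((ℓ i : ℤ) : ℝ)) ⬝ᵥ (fun i => ((ℓ i : ℤ) : ℝ))) +
            Real.sqrt ((fun i => ((K i : ℤ) : ℝ)) ⬝ᵥ (fun i => ((K i : ℤ) : ℝ))))) ≤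
      |((Real.sqrt ((fun i => (((ℓ + (0 : ℤ) • K) i : ℤ) : ℝ)) ⬝ᵥ (fun i => (((ℓ + (0 : ℤ) • K) i : ℤ) : ℝ))))⁻¹ •
          (fun i => (((ℓ + (0 : ℤ) • K) i : ℤ) : ℝ)) ⨯₃ ζr) ⬝ᵥ
        ((Real.sqrt ((fun i => (((ℓ + (1 : ℤ) • K) i : ℤ) : ℝ)) ⬝ᵥ (fun i => (((ℓ + (1 : ℤ) • K) i : ℤ) : ℝ))))⁻¹ •
          (fun i => (((ℓ + (1 : ℤ) • K) i : ℤ) : ℝ)) ⨯₃ ζr)| := by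
  set lr : Fin 3 → ℝ := fun i => ((ℓ i : ℤ) : ℝ) with hlr
  set Kr : Fin 3 → ℝ := fun i => ((K i : ℤ) : ℝ) with hKr
  have e0 : (fun i => (((ℓ + (0 : ℤ) • K) i : ℤ) : ℝ)) = lr := by funext i; simp [hlr]
  have e1 : (fun i => (((ℓ + (1 : ℤ) • K) i : ℤ) : ℝ)) = lr + Kr := by funext i; simp [hlr, hKr]
  have hpos : ∀ {v : Fin 3 → ℤ}, v ≠ 0 → 0 < (fun i => ((v i : ℤ) : ℝ)) ⬝ᵥ (fun i => ((v i : ℤ) : ℝ)) := by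
    intro v hv
    obtain ⟨i, hi⟩ : ∃ i, v i ≠ 0 := by
      by_contra h
      push Not at h
      exact hv (funext h)
    have hi' : ((v i : ℤ) : ℝ) ≠ 0 := by exact_mod_cast hi
    have e : (fun i => ((v i : ℤ) : ℝ)) ⬝ᵥ (fun i => ((v i : ℤ) : ℝ)) = ∑ l, ((v l : ℤ) : ℝ) ^ 2 := by simp [dotProduct, sq]
    rw [e]
    exact lt_of_lt_of_le (by positivity) (Finset.single_le_sum (fun l _ => sq_nonneg (((v l : ℤ) : ℝ))) (Finset.mem_univ i))
  have ha : 0 < lr ⬝ᵥ lr := hpos hℓ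
  have hb : 0 < Kr ⬝ᵥ Kr := hpos hK
  -- the link is the cosine between `ℓ` and `ℓ + K`
  have hcos := inPlane_link_eq_cos (ℓ + (0 : ℤ) • K) (ℓ + (1 : ℤ) • K) hζ1 (zeta_dot_coset hζ0 hζK 0) (zeta_dot_coset hζ0 hζK 1)
  rw [hcos, e0, e1]
  have hge := cos_coset_neighbour_ge lr Kr ha hb
  rw [abs_mul, abs_mul, abs_inv, abs_inv, abs_of_nonneg (Real.sqrt_nonneg _), abs_of_nonneg (Real.sqrt_nonneg _)]
  rw [div_eq_mul_inv, mul_inv] at hge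
  calc (|lr ⬝ᵥ Kr| - lr ⬝ᵥ lr) / (Real.sqrt (lr ⬝ᵥ lr) * (Real.sqrt (lr ⬝ᵥ lr) + Real.sqrt (Kr ⬝ᵥ Kr)))
      ≤ |lr ⬝ᵥ (lr + Kr)| / (Real.sqrt (lr ⬝ᵥ lr) * Real.sqrt ((lr + Kr) ⬝ᵥ (lr + Kr))) :=
        cos_coset_neighbour_ge lr Kr ha hb
    _ = (Real.sqrt (lr ⬝ᵥ lr))⁻¹ * (Real.sqrt ((lr + Kr) ⬝ᵥ (lr + Kr)))⁻¹ * |lr ⬝ᵥ (lr + Kr)| := by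
        rw [div_eq_mul_inv, mul_inv]; ring

/-- **`γ² > 0` for a principal coset with `|ℓ·K| > |ℓ|²`.** -/
theorem gamma_sq_pos (ℓ K : Fin 3 → ℤ) (hℓ : ℓ ≠ 0) (hK : K ≠ 0) {ζr : Fin 3 → ℝ} (hζ1 : ζr ⬝ᵥ ζr = 1)
    (hζ0 : ζr ⬝ᵥ (fun i => ((ℓ i : ℤ) : ℝ)) = 0) (hζK : ζr ⬝ᵥ (fun i => ((K i : ℤ) : ℝ)) = 0)
    (hfar : (fun i => ((ℓ i : ℤ) : ℝ)) ⬝ᵥ (fun i => ((ℓ i : ℤ) : ℝ)) <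
      |(fun i => ((ℓ i : ℤ) : ℝ)) ⬝ᵥ (fun i => ((K i : ℤ) : ℝ))|)
    {p : ℤ → Fin 3 → ℝ}
    (hp : ∀ J : ℤ, p J = (Real.sqrt ((fun i => (((ℓ + J • K) i : ℤ) : ℝ)) ⬝ᵥ (fun i => (((ℓ + J • K) i : ℤ) : ℝ))))⁻¹ •
        (fun i => (((ℓ + J • K) i : ℤ) : ℝ)) ⨯₃ ζr) :
    0 < (p 0 ⬝ᵥ p 1) ^ 2 + (p (-1) ⬝ᵥ p 0) ^ 2 := by
  have h := abs_inPlane_link_ge ℓ K hℓ hK hζ1 hζ0 hζK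
  rw [← hp 0, ← hp 1] at h
  have hnum : 0 < |(fun i => ((ℓ i : ℤ) : ℝ)) ⬝ᵥ (fun i => ((K i : ℤ) : ℝ))| -
      (fun i => ((ℓ i : ℤ) : ℝ)) ⬝ᵥ (fun i => ((ℓ i : ℤ) : ℝ)) := by linarith
  have ha : 0 < (fun i => ((ℓ i : ℤ) : ℝ)) ⬝ᵥ (fun i => ((ℓ i : ℤ) : ℝ)) := by
    have h0 : 0 ≤ |(fun i => ((ℓ i : ℤ) : ℝ)) ⬝ᵥ (fun i => ((K i : ℤ) : ℝ))| := abs_nonneg _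
    -- `ℓ ≠ 0`
    obtain ⟨i, hi⟩ : ∃ i, ℓ i ≠ 0 := by
      by_contra h'
      push Not at h'
      exact hℓ (funext h')
    have hi' : ((ℓ i : ℤ) : ℝ) ≠ 0 := by exact_mod_cast hi
    have e : (fun i => ((ℓ i : ℤ) : ℝ)) ⬝ᵥ (fun i => ((ℓ i : ℤ) : ℝ)) = ∑ l, ((ℓ l : ℤ) : ℝ) ^ 2 := by simp [dotProduct, sq]
    rw [e]
    exact lt_of_lt_of_le (by positivity) (Finset.single_le_sum (fun l _ => sq_nonneg (((ℓ l : ℤ) : ℝ))) (Finset.mem_univ i))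
  have hden : 0 < Real.sqrt ((fun i => ((ℓ i : ℤ) : ℝ)) ⬝ᵥ (fun i => ((ℓ i : ℤ) : ℝ))) *
      (Real.sqrt ((fun i => ((ℓ i : ℤ) : ℝ)) ⬝ᵥ (fun i => ((ℓ i : ℤ) : ℝ))) +
        Real.sqrt ((fun i => ((K i : ℤ) : ℝ)) ⬝ᵥ (fun i => ((K i : ℤ) : ℝ)))) := by
    have h1 : 0 < Real.sqrt ((fun i => ((ℓ i : ℤ) : ℝ)) ⬝ᵥ (fun i => ((ℓ i : ℤ) : ℝ))) := Real.sqrt_pos.2 ha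
    have h2 : 0 ≤ Real.sqrt ((fun i => ((K i : ℤ) : ℝ)) ⬝ᵥ (fun i => ((K i : ℤ) : ℝ))) := Real.sqrt_nonneg _
    positivity
  have hlink : 0 < |p 0 ⬝ᵥ p 1| := lt_of_lt_of_le (div_pos hnum hden) h
  have hsq : 0 < (p 0 ⬝ᵥ p 1) ^ 2 := by
    have := abs_pos.1 hlink
    positivity
  nlinarith [sq_nonneg (p (-1) ⬝ᵥ p 0)]

end Summit.AnomalousDissipation.AnomalousDissipation.Theorems.SolenoidalFractalHomogenisation.RealisedQuasiStaticCellLaw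

end
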